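import Summits.QuantumFields.BalabanUV.Beta.GAN24.ValueReadoutLipschitz
import Summits.QuantumFields.BalabanUV.Beta.GAN24.SecondOrderLipschitzBi

/-!
# `BalabanUV.Beta.GAN24.TransportStepLipschitz` — THE ONE-STEP TRANSPORT OF THE NORMALISED `T2Of` RECURSION IS LIPSCHITZ IN THE KERNEL AT A
# FIXED TABLE: `𝒜_K[X] − 𝒜_{K′}[X]` for leaf-04's linear part `𝒜_K[X] = lin4 c K N X = −(c • mmRead N (K ∘ vsym K N X ∘ K))`
# (G-an2-4 formalisation swarm, leaf prover 08, gen 16; the Lipschitz input of the SECOND summand `(𝒜_{m+1} − 𝒜_m)[x_m]` of the forcing of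
# ROW W3-F4b ∕ END #2 `WSlotT2OfPieces.rate_of_rows` of the owner's SKELETON-W3 v1.0 §8.3; journal CLAIMS l.8210; name PROVISIONAL)

NOT IN PRINT; OUR PROOF (elementary).  HONEST FRAMING (cell contract, verbatim): «discharging `BetaPertH` makes Bałaban's UV stability
UNCONDITIONAL — a real constructive-QFT result; it is NOT the continuum limit and NOT the Clay problem.»  HONEST DEPENDENCY (verbatim):
«continuum YM on T⁴ ⇐ BetaPertH ∧ nine spine estimates (0/9 proved); BetaPertH ⇐ (D1) ∧ (D4) ∧ CAP+tail; G-an2-4 gates asym, D1 and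
NE2/3/4.»

THE OBJECT.  leaf-04's affine split (`T2RecursionAffine`, p210349 — at the gate; NOT imported here): `T♮_{j+1} = b_j + lin4 c K♮_j Lc T♮_j` with
`lin4 c K N T κ u κ′ u′ := −(c • mmRead N (K ∘ vsym K N T κ u κ′ u′ ∘ K))`, `vsym K N T μ y ν y′ := ½ • (vertex2OfK K N T μ y ν y′ + vertex2OfK K N T ν y′ μ y)`,
`c = cE₂·Lc^{2(d+1)}`.  The forcing of the DIFFERENCE tower (leaf-01's `AffineUnroll.diff_eq_transport_add_sum`) is
`f_m = (b_{m+1} − b_m) + (𝒜_{m+1} − 𝒜_m)[x_m]`; the first summand's geometric `LocStencil₂` bound is `W3SourceRows.source_cauchy_of_shapes`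
(p211794); THIS module is the kernel-Lipschitz input of the second: for a FIXED bi-stencil table `X`,
`LocStencil₂ (lin4 c K N X − lin4 c K′ N X) (|c| · lSand d C (cBi d C C₂ m) εK (lBi d C C₂ εK 0 m) (m/32)) (m/128)` — written over TREE names with
`lin4`∕`vsym` UNFOLDED (both are `rfl`-definitions of leaf-04's module, so the statements below ARE the `lin4` statements by `rfl` once p210349
lands).  Route ([folklore]; every analytic brick BY NAME): an2's `vertexFamily₂_vertex2OfK` ∕ `_swap` (shape `cBi`, rate `m/8`) and leaf-03's
`SecondOrderLipschitzBi.vertexFamily₂_vertex2OfK_sub` ∕ `_swap_sub` (deviation `lBi … εK 0`, the table deviation being `0`) for the symmetrised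
bi-vertex; pair + swap ⟹ far form (an2's `biLoc_far_of_pair`); this lineage's `ValueReadoutLipschitz.biLoc_sandwich_sub_far` (leaf-03's
`biLoc_sandwich_sub` with the far factor pulled through); an2's `biLoc_mmRead`; constants EXPLICIT and LINEAR in `εK` (`lSand_lBi_mul`), ONE
fixed output rate `m/128`, constants OUTSIDE every `∀` (RULINGS-12 (R12-2)).
* §1 `far_of_pair_swap` (pair-form `VertexFamily₂` + swap ⟹ far form at the first bond, any rate `r ≤ m′/4`), `neg_smul_sub_neg_smul`;
* §2 **`vertexFamily₂_symBi`**, `symBi_swap`, **`vertexFamily₂_symBi_sub`** — the symmetrised bi-vertex of a fixed table: shape and K-Lipschitz;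
* §3 **`locStencil₂_lin_sub`** — THE TRANSPORT STEP IS LIPSCHITZ IN `K` AT A FIXED TABLE; `lSand_lBi_mul`; **`lin_cauchy`** — family form:
  `j`-uniform kernels with `(k+j, k)`-deviations `cK·θ^k` ⟹ `LocStencil₂ (𝒜_{K_{k+j}}[X] − 𝒜_{K_k}[X]) (|c|·lSand(…, cK, …)·θ^k) (m/128)`.
NOT HERE: the `x_m` factor's uniform shape (END #1 ∕ ROW W3-F3a (T-marg)), the `mom` conjuncts, the composite (`k ≥ 2`) transport.

HONEST: generic kernel algebra; instantiates NO binder, asserts NO shape or rate of Bałaban's tables («T2Shape» ∕ «T2SupRate» OPEN, NOT IN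
PRINT), discharges NOTHING of (hW, hWall); NOT «W-slot closed», NEVER «G-an2-4 closed», NOT (CONV-C); NOT BetaPertH, NOT continuum, NOT
Clay.  0 sorry, 0 cite, 0 `def … : Prop`, 0 def.
-/

noncomputable section

open Finset
open scoped BigOperators
open Literature.MathematicalPhysics.QuantumFieldTheory
open Literature.MathematicalPhysics.QuantumFieldTheory.Balaban1983to89
open Literature.MathematicalPhysics.QuantumFieldTheory.Balaban1983to89.Beta
open B12Sec2to5 (l1 l1_nonneg)
open ExpKernelCalculus (MKer Decays BiLoc VertexFamily VertexFamily₂ comp Zl Zl_nonneg l1_sub_symm)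
open OneStepResolventKernel (Fib LocStencil decays_mono biLoc_mono)
open KernelWard (biLoc_add)
open BalabanStepJets (vertexFamily₂_mono)
open BalabanStepJetsSucc (mmRead biLoc_mmRead l1_sub_le_l1_smul_sub)
open BalabanCompositeJets (LocStencil₂)
open SecondOrderResponse (vertex2OfK vertexFamily₂_vertex2OfK vertexFamily₂_vertex2OfK_swap cBi cBi_nonneg biLoc_smul)
open BalabanStepW2 (biLoc_le_mono biLoc_far_of_pair)
open Summit.QuantumFields.BalabanUV.Beta.GAN24.SecondOrderLipschitz (lSand lSand_nonneg)
open Summit.QuantumFields.BalabanUV.Beta.GAN24.SecondOrderLipschitzBi (lBi lBi_nonneg vertexFamily₂_vertex2OfK_sub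
  vertexFamily₂_vertex2OfK_swap_sub)
open Summit.QuantumFields.BalabanUV.Beta.GAN24.ThirdJetKernel (mmRead_sub)
open Summit.QuantumFields.BalabanUV.Beta.GAN24.ValueReadoutLipschitz (biLoc_sandwich_sub_far)

namespace Summit.QuantumFields.BalabanUV.Beta.GAN24.TransportStepLipschitz

variable {d : ℕ} {N : ℕ}

/-! ## §1 Bookkeeping -/

/-- [folklore] **PAIR FORM + SWAP ⟹ FAR FORM AT THE FIRST BOND** (an2's `biLoc_far_of_pair`, packaged for a whole family): a `VertexFamily₂`
at rate `m′` that is symmetric under `(μ, y) ↔ (ν, y′)` is, member by member, bi-localised at `N•y` at any rate `r` with `4r ≤ m′`, with a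
constant decaying at rate `r` in `|N•y′ − N•y|₁` (the far rate `m′/2` of the brick weakened to `r`). -/
theorem far_of_pair_swap {V : Fin (d + 1) → (Fin (d + 1) → ℤ) → Fin (d + 1) → (Fin (d + 1) → ℤ) → MKer (d + 1) (Fib d)} {Cv m' r : ℝ}
    (hCv : 0 ≤ Cv) (hV : VertexFamily₂ V N Cv m') (hVs : ∀ μ y ν y', V ν y' μ y = V μ y ν y') (hr0 : 0 ≤ r) (hr : 4 * r ≤ m')
    (μ : Fin (d + 1)) (y : Fin (d + 1) → ℤ) (ν : Fin (d + 1)) (y' : Fin (d + 1) → ℤ) :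
    BiLoc (V μ y ν y') ((N : ℤ) • y) ((N : ℤ) • y) (Cv * Real.exp (-r * l1 ((N : ℤ) • y' - (N : ℤ) • y))) r := by
  have h2 : BiLoc (V μ y ν y') ((N : ℤ) • y') ((N : ℤ) • y) Cv m' := by
    rw [← hVs μ y ν y']
    exact hV ν y' μ y
  refine biLoc_le_mono (biLoc_far_of_pair (hV μ y ν y') h2 (by linarith)) (by positivity) ?_ (by linarith)
  exact mul_le_mul_of_nonneg_left (Real.exp_le_exp.2 (by nlinarith [l1_nonneg ((N : ℤ) • y' - (N : ℤ) • y)])) hCv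

/-- [folklore] `−(c • A) − (−(c • B)) = (−c) • (A − B)` for kernels. -/
theorem neg_smul_sub_neg_smul (c : ℝ) (A B : MKer (d + 1) (Fib d)) : -(c • A) - -(c • B) = (-c) • (A - B) := by
  rw [sub_neg_eq_add, neg_add_eq_sub, neg_smul, smul_sub, neg_sub]

/-! ## §2 The symmetrised bi-vertex of a FIXED table: shape, swap symmetry, Lipschitz in the kernel -/

/-- [folklore] **THE SYMMETRISED BI-VERTEX OF A FIXED TABLE IS A VERTEX FAMILY** (an2's `vertexFamily₂_vertex2OfK` + `_swap`, halved and
added: `|½|·(cBi + cBi) = cBi`), rate `m/8` — leaf-04's `vsym K N X`, unfolded. -/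
theorem vertexFamily₂_symBi {K : MKer (d + 1) (Fib d)} {C m : ℝ} (hK : Decays K C m) (hC : 0 ≤ C)
    {X : Fin (d + 1) → (Fin (d + 1) → ℤ) → Fin (d + 1) → (Fin (d + 1) → ℤ) → MKer (d + 1) (Fib d)} {C₂ : ℝ} (hX : LocStencil₂ X C₂ m)
    (hm : 0 < m) :
    VertexFamily₂ (fun μ y ν y' => (1 / 2 : ℝ) • (vertex2OfK K N X μ y ν y' + vertex2OfK K N X ν y' μ y)) N (cBi d C C₂ m) (m / 8) := by
  intro μ y ν y'
  have h := biLoc_smul (1 / 2 : ℝ)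
    (biLoc_add (vertexFamily₂_vertex2OfK (N := N) hK hC hX hm μ y ν y') (vertexFamily₂_vertex2OfK_swap (N := N) hK hC hX hm μ y ν y'))
  have e : |(1 / 2 : ℝ)| * (cBi d C C₂ m + cBi d C C₂ m) = cBi d C C₂ m := by
    rw [abs_of_pos (by norm_num : (0 : ℝ) < 1 / 2)]
    ring
  rw [e] at h
  exact h

/-- [folklore] The symmetrised bi-vertex is symmetric under `(μ, y) ↔ (ν, y′)`. -/
theorem symBi_swap (K : MKer (d + 1) (Fib d)) (X : Fin (d + 1) → (Fin (d + 1) → ℤ) → Fin (d + 1) → (Fin (d + 1) → ℤ) → MKer (d + 1) (Fib d))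
    (μ : Fin (d + 1)) (y : Fin (d + 1) → ℤ) (ν : Fin (d + 1)) (y' : Fin (d + 1) → ℤ) :
    (1 / 2 : ℝ) • (vertex2OfK K N X ν y' μ y + vertex2OfK K N X μ y ν y')
      = (1 / 2 : ℝ) • (vertex2OfK K N X μ y ν y' + vertex2OfK K N X ν y' μ y) := by
  rw [add_comm (vertex2OfK K N X ν y' μ y) (vertex2OfK K N X μ y ν y')]

/-- [folklore] **THE SYMMETRISED BI-VERTEX OF A FIXED TABLE IS LIPSCHITZ IN THE KERNEL**: for `K, K′` decaying at rate `m` (constant `C`,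
deviation `Decays (K − K′) εK m`) and ONE table `X` (`LocStencil₂ X C₂ m`), the two symmetrised bi-vertices differ by a `VertexFamily₂` with constant
`lBi d C C₂ εK 0 m` (leaf-03's bi-vertex Lipschitz constant at table deviation `0`), rate `m/8`. -/
theorem vertexFamily₂_symBi_sub {K K' : MKer (d + 1) (Fib d)} {C εK m : ℝ} (hK : Decays K C m) (hK' : Decays K' C m)
    (hKK : Decays (K - K') εK m) (hm : 0 < m)
    {X : Fin (d + 1) → (Fin (d + 1) → ℤ) → Fin (d + 1) → (Fin (d + 1) → ℤ) → MKer (d + 1) (Fib d)} {C₂ : ℝ} (hX : LocStencil₂ X C₂ m) :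
    VertexFamily₂ (fun μ y ν y' => (1 / 2 : ℝ) • (vertex2OfK K N X μ y ν y' + vertex2OfK K N X ν y' μ y)
        - (1 / 2 : ℝ) • (vertex2OfK K' N X μ y ν y' + vertex2OfK K' N X ν y' μ y)) N (lBi d C C₂ εK 0 m) (m / 8) := by
  have hXX : LocStencil₂ (X - X) 0 m := by
    intro κ u κ' u' x z a b
    simp only [sub_self, Pi.zero_apply, abs_zero]
    positivity
  intro μ y ν y'
  have h1 := vertexFamily₂_vertex2OfK_sub (N := N) hK hK' hKK hm hX hX hXX μ y ν y'
  have h2 := vertexFamily₂_vertex2OfK_swap_sub (N := N) hK hK' hKK hm hX hX hXX μ y ν y'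
  have h := biLoc_smul (1 / 2 : ℝ) (biLoc_add h1 h2)
  have e1 : |(1 / 2 : ℝ)| * (lBi d C C₂ εK 0 m + lBi d C C₂ εK 0 m) = lBi d C C₂ εK 0 m := by
    rw [abs_of_pos (by norm_num : (0 : ℝ) < 1 / 2)]
    ring
  rw [e1] at h
  have e : (1 / 2 : ℝ) • (vertex2OfK K N X μ y ν y' + vertex2OfK K N X ν y' μ y)
        - (1 / 2 : ℝ) • (vertex2OfK K' N X μ y ν y' + vertex2OfK K' N X ν y' μ y)
      = (1 / 2 : ℝ) • ((vertex2OfK K N X - vertex2OfK K' N X) μ y ν y'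
          + (fun μ y ν y' => (vertex2OfK K N X - vertex2OfK K' N X) ν y' μ y) μ y ν y') := by
    funext x z a b
    simp only [Pi.sub_apply, Pi.add_apply, Pi.smul_apply, smul_eq_mul]
    ring
  show BiLoc ((1 / 2 : ℝ) • (vertex2OfK K N X μ y ν y' + vertex2OfK K N X ν y' μ y)
      - (1 / 2 : ℝ) • (vertex2OfK K' N X μ y ν y' + vertex2OfK K' N X ν y' μ y)) ((N : ℤ) • y) ((N : ℤ) • y') (lBi d C C₂ εK 0 m) (m / 8)
  rw [e]
  exact h

/-! ## §3 The transport step is Lipschitz in the kernel at a fixed table -/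

section Lin

variable {Lc : ℕ}

/-- [folklore] **THE TRANSPORT STEP IS LIPSCHITZ IN THE KERNEL AT A FIXED TABLE.**  For packed kernels `K, K′` decaying at rate `m` (constant `C`,
deviation `Decays (K − K′) εK m`), a FIXED bi-stencil table `X` (`LocStencil₂ X C₂ m`) and a scalar `c`, leaf-04's linear parts
`𝒜_K[X] = −(c • mmRead Lc (K ∘ vsym K Lc X ∘ K))` (written unfolded) differ by
`LocStencil₂ (𝒜_K[X] − 𝒜_{K′}[X]) (|c| · lSand d C (cBi d C C₂ m) εK (lBi d C C₂ εK 0 m) (m/32)) (m/128)` — the symmetrised bi-vertices by §2 (rate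
`m/8`), their far forms by `far_of_pair_swap` (rate `m/32`), the kernels weakened to `m/32`, the sandwich difference by
`ValueReadoutLipschitz.biLoc_sandwich_sub_far` (rate `m/128`), read at the coarse points by an2's `biLoc_mmRead`.  ONE fixed output rate,
constant OUTSIDE every `∀`, LINEAR in `εK`. -/
theorem locStencil₂_lin_sub (hLc : 1 ≤ Lc) {K K' : MKer (d + 1) (Fib d)} {C εK m : ℝ} (hK : Decays K C m) (hK' : Decays K' C m)
    (hKK : Decays (K - K') εK m) (hm : 0 < m)
    {X : Fin (d + 1) → (Fin (d + 1) → ℤ) → Fin (d + 1) → (Fin (d + 1) → ℤ) → MKer (d + 1) (Fib d)} {C₂ : ℝ} (hX : LocStencil₂ X C₂ m)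
    (c : ℝ) :
    LocStencil₂ (fun κ u κ' u' =>
        -(c • mmRead Lc (comp (comp K ((1 / 2 : ℝ) • (vertex2OfK K Lc X κ u κ' u' + vertex2OfK K Lc X κ' u' κ u))) K))
          - -(c • mmRead Lc (comp (comp K' ((1 / 2 : ℝ) • (vertex2OfK K' Lc X κ u κ' u' + vertex2OfK K' Lc X κ' u' κ u))) K')))
      (|c| * lSand d C (cBi d C C₂ m) εK (lBi d C C₂ εK 0 m) (m / 32)) (m / 128) := by
  have hC : 0 ≤ C := hK.nonneg (Sum.inl 0)
  have hεK : 0 ≤ εK := hKK.nonneg (Sum.inl 0)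
  have hC₂ : 0 ≤ C₂ := hX.nonneg
  have hcBi : 0 ≤ cBi d C C₂ m := cBi_nonneg hC hC₂ hm
  have hlBi : 0 ≤ lBi d C C₂ εK 0 m := lBi_nonneg hC hC₂ hεK le_rfl hm
  have hm32 : 0 < m / 32 := by positivity
  have hL : 0 ≤ lSand d C (cBi d C C₂ m) εK (lBi d C C₂ εK 0 m) (m / 32) := lSand_nonneg hC hcBi hεK hlBi hm32
  -- the symmetrised bi-vertices: pair form at rate `m/8`, far form at rate `m/32`
  have hV := vertexFamily₂_symBi (N := Lc) hK hC hX hm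
  have hV' := vertexFamily₂_symBi (N := Lc) hK' hC hX hm
  have hVV := vertexFamily₂_symBi_sub (N := Lc) hK hK' hKK hm hX
  have hVVs : ∀ (μ : Fin (d + 1)) (y : Fin (d + 1) → ℤ) (ν : Fin (d + 1)) (y' : Fin (d + 1) → ℤ),
      ((fun μ y ν y' => (1 / 2 : ℝ) • (vertex2OfK K Lc X μ y ν y' + vertex2OfK K Lc X ν y' μ y)
          - (1 / 2 : ℝ) • (vertex2OfK K' Lc X μ y ν y' + vertex2OfK K' Lc X ν y' μ y)) ν y' μ y)
        = (fun μ y ν y' => (1 / 2 : ℝ) • (vertex2OfK K Lc X μ y ν y' + vertex2OfK K Lc X ν y' μ y)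
          - (1 / 2 : ℝ) • (vertex2OfK K' Lc X μ y ν y' + vertex2OfK K' Lc X ν y' μ y)) μ y ν y' := by
    intro μ y ν y'
    dsimp only
    rw [symBi_swap K X μ y ν y', symBi_swap K' X μ y ν y']
  have h432 : 4 * (m / 32) ≤ m / 8 := by linarith
  have hVfar := far_of_pair_swap hcBi hV (fun μ y ν y' => symBi_swap K X μ y ν y') hm32.le h432
  have hV'far := far_of_pair_swap hcBi hV' (fun μ y ν y' => symBi_swap K' X μ y ν y') hm32.le h432
  have hVVfar := far_of_pair_swap hlBi hVV hVVs hm32.le h432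
  -- the kernels at rate `m/32`
  have hK32 : Decays K C (m / 32) := decays_mono hK hC le_rfl (by linarith)
  have hK'32 : Decays K' C (m / 32) := decays_mono hK' hC le_rfl (by linarith)
  have hKK32 : Decays (K - K') εK (m / 32) := decays_mono hKK hεK le_rfl (by linarith)
  intro κ u κ' u'
  have h := biLoc_sandwich_sub_far hK32 hK'32 hKK32 hm32 (hVfar κ u κ' u') (hV'far κ u κ' u') (hVVfar κ u κ' u')
  -- h : BiLoc (K∘V∘K − K′∘V′∘K′) (Lc•u) (Lc•u) (lSand … (m/32) · e^{−(m/32)|Lc•u′ − Lc•u|₁}) (m/32/4)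
  have h' : BiLoc (comp (comp K ((1 / 2 : ℝ) • (vertex2OfK K Lc X κ u κ' u' + vertex2OfK K Lc X κ' u' κ u))) K
        - comp (comp K' ((1 / 2 : ℝ) • (vertex2OfK K' Lc X κ u κ' u' + vertex2OfK K' Lc X κ' u' κ u))) K')
      ((Lc : ℤ) • u) ((Lc : ℤ) • u)
      (lSand d C (cBi d C C₂ m) εK (lBi d C C₂ εK 0 m) (m / 32) * Real.exp (-(m / 128) * l1 (u' - u))) (m / 128) := by
    refine biLoc_le_mono h (by positivity) ?_ (by linarith)
    exact mul_le_mul_of_nonneg_left (Real.exp_le_exp.2 (by nlinarith [l1_sub_le_l1_smul_sub hLc u' u, l1_nonneg (u' - u), hm32])) hL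
  have hr := biLoc_smul (-c) (biLoc_mmRead hLc h' (by positivity))
  rw [abs_neg, mmRead_sub] at hr
  show BiLoc (-(c • mmRead Lc (comp (comp K ((1 / 2 : ℝ) • (vertex2OfK K Lc X κ u κ' u' + vertex2OfK K Lc X κ' u' κ u))) K))
      - -(c • mmRead Lc (comp (comp K' ((1 / 2 : ℝ) • (vertex2OfK K' Lc X κ u κ' u' + vertex2OfK K' Lc X κ' u' κ u))) K'))) u u
    (|c| * lSand d C (cBi d C C₂ m) εK (lBi d C C₂ εK 0 m) (m / 32) * Real.exp (-(m / 128) * l1 (u' - u))) (m / 128)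
  rw [neg_smul_sub_neg_smul, mul_assoc]
  exact hr

/-- [folklore] Linearity of the transport Lipschitz constant in the kernel deviation (leaf-03's `lSand` and `lBi` are linear in their deviation
slots): how geometric kernel deviations become geometric transport deviations. -/
theorem lSand_lBi_mul (d : ℕ) (C CV C₂ εK m m' t : ℝ) :
    lSand d C CV (εK * t) (lBi d C C₂ (εK * t) 0 m) m' = lSand d C CV εK (lBi d C C₂ εK 0 m) m' * t := by
  simp only [lSand, lBi]
  ring

/-- [folklore] **FAMILY (CAUCHY) FORM: GEOMETRICALLY CONVERGENT KERNELS ⟹ GEOMETRICALLY CONVERGENT TRANSPORT STEPS AT A FIXED TABLE.**  For a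
family of packed kernels with `j`-UNIFORM decay data `(C, m)` whose members `k+j`, `k` differ by `Decays (K (k+j) − K k) (cK·θ^k) m`, a fixed table
`X` and scalar `c`: `LocStencil₂ (𝒜_{K_{k+j}}[X] − 𝒜_{K_k}[X]) (|c| · lSand d C (cBi d C C₂ m) cK (lBi d C C₂ cK 0 m) (m/32) · θ^k) (m/128)` — no sign or
size condition on `θ` is used.  (For an2's data: `K j := unitK (sfStep Lc j) (smStep d Lc j) (KInvStep Lc j)`, `cK·θ^k` from `CauchyDecayK`.) -/
theorem lin_cauchy (hLc : 1 ≤ Lc) {K : ℕ → MKer (d + 1) (Fib d)} {C cK m θ : ℝ} (hm : 0 < m) (hK : ∀ j, Decays (K j) C m)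
    (hKc : ∀ k j, Decays (K (k + j) - K k) (cK * θ ^ k) m)
    {X : Fin (d + 1) → (Fin (d + 1) → ℤ) → Fin (d + 1) → (Fin (d + 1) → ℤ) → MKer (d + 1) (Fib d)} {C₂ : ℝ} (hX : LocStencil₂ X C₂ m)
    (c : ℝ) (k j : ℕ) :
    LocStencil₂ (fun κ u κ' u' =>
        -(c • mmRead Lc (comp (comp (K (k + j))
            ((1 / 2 : ℝ) • (vertex2OfK (K (k + j)) Lc X κ u κ' u' + vertex2OfK (K (k + j)) Lc X κ' u' κ u))) (K (k + j))))
          - -(c • mmRead Lc (comp (comp (K k) ((1 / 2 : ℝ) • (vertex2OfK (K k) Lc X κ u κ' u' + vertex2OfK (K k) Lc X κ' u' κ u))) (K k))))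
      (|c| * lSand d C (cBi d C C₂ m) cK (lBi d C C₂ cK 0 m) (m / 32) * θ ^ k) (m / 128) := by
  have h := locStencil₂_lin_sub hLc (hK (k + j)) (hK k) (hKc k j) hm hX c
  rw [lSand_lBi_mul, ← mul_assoc] at h
  exact h

end Lin

end Summit.QuantumFields.BalabanUV.Beta.GAN24.TransportStepLipschitz

end
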